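import Mathlib.Algebra.Polynomial.Div
import Mathlib.Algebra.Polynomial.AlgebraMap
import Mathlib.Algebra.Polynomial.Degree.SmallDegree
import Mathlib.Data.Int.GCD
import Mathlib.Data.Nat.Factorization.Basic
import Literature.NumberTheory.EllipticCurves.AnticyclotomicBigGaloisRep
import HarnessLib

/-!
# `Frob_w - 1` is SURJECTIVE on the co-induced big representation `T ⊗ Λ^*(Ψ⁻¹)` at an unramified
# place — the algebraic engine behind `ℋ^ur_w(𝒜) = 0` (Castella 2018 §2.2; Pollack–Weston 2011)

Topic `NumberTheory/EllipticCurves`; namespace `Literature.NumberTheory.EllipticCurves.BigRepModule`.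
THEOREMS ONLY (no definition, no named fact, no instance; D-0026).  Written for the discharge of the
named fact `Castella2018.selmerBig_eq_selmerBigDecomp_of_unramifiedOutside`
(`Castella2018/SigmaSelmerUnramifiedOutsideS.lean`; plan `pub/bsd-cited/sheets/NOTE-r17-SigmaBridge-
discharge-plan-df9ef7a3.md`, module M2): by the tree's unramified-class criterion
(`GaloisRepresentations/LocalHOneInertiaRestrictionProfinite.lean`,
`oneCocycleClass_eq_zero_iff_of_vanishing_absInertia`) the vanishing of
`ℋ^ur_w = ker(H¹(K_w, 𝒜) → H¹(I_w, 𝒜))` for the co-induced module `𝒜 = BigRepModule 𝒪 p A`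
(`AnticyclotomicBigGaloisRep`; inertia acting trivially) reduces to the SURJECTIVITY of `φ - 1` on `𝒜`
for a Frobenius lift `φ`.  Printed source of the statement: F. Castella, Camb. J. Math. 6 (2018) §2.2
[arXiv:1704.06608 TeX p. 7]: "For primes `v ∤ p` which are split in `K`, it is easy to see that the
restriction map `H¹(K_v, M) → H¹(I_v, M)` is injective (see [PW11]), and so `ℋ^ur_v` vanishes", and
"`ℋ^ur_w ≃ (ℤ_p/p^{t_E(w)}ℤ_p) ⊗ Λ^*`, where `t_E(w) := ord_p(c_w(E/K))`" (so `ℋ^ur_w = 0` at a good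
`w`).  Here this is proved in the co-induced model `(g·Φ)(x) = ρ(g)(Φ(x - κ g))`
(`bigRep_apply_apply`) by an argument that needs NEITHER the Hasse bound NOR the split/inert case
distinction:

* §1–§2 (`translate_pow`, `zsmul_apply`, private helpers): bookkeeping on translations `τ_c` and
  integer scalars (§3–§4 are private lemmas of this file; the two cited results are §5 and §6).
* §3 (`X_pow_eq_mul_divByMonic_add`, `chi_mul_U_eq`, `resultant_ne_zero`): for `χ = X² - tX + q ∈ ℤ[X]`
  and `m` odd, division `X^m = χ·V + (aX + b')` gives the identity
  `χ·U = d + W·(X^m - 1)` with `d = a²q + ta(b'-1) + (b'-1)² = Res(χ, X^m - 1)`, and `d ≠ 0` as soon as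
  `q ≠ ±1` and `t ≠ q + 1` (a rational root `r` of `χ` with `r^m = 1`, `m` odd, forces `r = 1`).
* §4 (`exists_pow_smul_eq_of_level`, `exists_zsmul_eq_of_level`): a non-zero integer divides every
  smooth function of level `N` by a smooth function of level `N`, `A` being `p`-divisible.
* §5 (`aeval_translate_quadratic_surjective`): **`χ(τ_c) = τ_{2c} - t τ_c + q` is surjective** on
  `BigRepModule 𝒪 p A` for every `c ∈ ℤ_p` (`p` odd): on level-`N` functions `τ_c^{p^N} = 1`
  (`translate_eq_self_of_mem`), so `χ(τ_c)·U(τ_c) = d` there.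
* §6 (`bigRep_sub_self_surjective`): if `ρ(g)` satisfies a Cayley–Hamilton relation
  `ρ(g)² = t ρ(g) - q` on `A` (for `A = E[p^∞]`, `g` a Frobenius at a good `w`: `t = a_w`, `q = q_w`,
  tree `charpoly_galoisRepTate_of_hasGoodReductionAt`), then `(ρ(g)τ - 1)((t - ρ(g))τ - 1) = τ²χ(τ⁻¹)`
  and **`g - 1` is surjective on `BigRepModule 𝒪 p A`**.

References: [Castella2018] §2.2 (the two `ℋ^ur` sentences, display (eq:defs)); [PollackWeston2011AMU]
§3 (as cited by [Castella2018]); [SkinnerUrban2014] §3.1.3 (the co-induced model).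
-/

noncomputable section

open Polynomial

namespace Literature.NumberTheory.EllipticCurves.BigRepModule

variable {𝒪 : Type*} [CommRing 𝒪] {p : ℕ} [Fact p.Prime] {A : Type*} [AddCommGroup A] [Module 𝒪 A]

/-! ### §1. Integer scalars and powers of translations -/

/-- The module operations on `Maps(Γ, A)` are pointwise: INTEGER multiples (companion of the tree's
`nsmul_apply` / `smul_apply`). [cite: SkinnerUrban2014, §3.1.3 and proof of Prop. 3.2.3 (Λ^* = lim Hom(ℤ[Gal(F_n/F)], ·))] -/
theorem zsmul_apply (n : ℤ) (Φ : BigRepModule 𝒪 p A) (x : ℤ_[p]) : (n • Φ) x = n • Φ x := by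
  rw [← Int.cast_smul_eq_zsmul 𝒪 n Φ, smul_apply, Int.cast_smul_eq_zsmul]

/-- `τ_c^n = τ_{nc}` (the regular action of `Γ` on `Maps(Γ, A)` is an action; companion of the tree's
`translate_zero` / `translate_add`). [cite: SkinnerUrban2014, §3.1.3 and proof of Prop. 3.2.3 (Λ^* = lim Hom(ℤ[Gal(F_n/F)], ·))] -/
theorem translate_pow (c : ℤ_[p]) (n : ℕ) :
    (translate c : BigRepModule 𝒪 p A →ₗ[𝒪] BigRepModule 𝒪 p A) ^ n = translate ((n : ℤ_[p]) * c) := by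
  induction n with
  | zero => rw [pow_zero, Nat.cast_zero, zero_mul, translate_zero]; rfl
  | succ n ih =>
    rw [pow_succ, ih, Module.End.mul_eq_comp, ← translate_add, Nat.cast_succ, add_mul, one_mul]

/-- On functions of level `N` every translation has order dividing `p^N`: `τ_c^{p^N} Φ = Φ`
(`p^N c ∈ p^N ℤ_p` fixes `Maps(Γ/Γ^{p^N}, A)`). [folklore] -/
private theorem translate_pow_prime_pow_apply_of_level {N : ℕ} {Φ : BigRepModule 𝒪 p A}
    (hΦ : IsSmoothOfLevel p A N Φ) (c : ℤ_[p]) :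
    ((translate c : BigRepModule 𝒪 p A →ₗ[𝒪] BigRepModule 𝒪 p A) ^ (p ^ N)) Φ = Φ := by
  rw [translate_pow]
  exact translate_eq_self_of_mem hΦ
    (by rw [Nat.cast_pow]; exact Ideal.mul_mem_right _ _ (Ideal.mem_span_singleton_self _))

/-- A scalar multiple of a level-`N` function has level `N`. [folklore] -/
private theorem isSmoothOfLevel_zsmul {N : ℕ} {Φ : BigRepModule 𝒪 p A} (hΦ : IsSmoothOfLevel p A N Φ) (n : ℤ) :
    IsSmoothOfLevel p A N (n • Φ) := fun x y hxy ↦ by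
  change (n • Φ) x = (n • Φ) y
  rw [zsmul_apply, zsmul_apply, hΦ x y hxy]

/-! ### §2. Evaluating integer polynomials at a translation -/

/-- `χ(τ_c)Φ (x) = Φ(x + 2c) - t Φ(x + c) + q Φ(x)` for `χ = X² - tX + q`. [folklore] -/
private theorem aeval_translate_quadratic_apply (t q : ℤ) (c : ℤ_[p]) (Φ : BigRepModule 𝒪 p A) (x : ℤ_[p]) :
    (aeval (translate c : Module.End 𝒪 (BigRepModule 𝒪 p A)) (X ^ 2 - C t * X + C q) Φ) x =
      Φ (x + c + c) - t • Φ (x + c) + q • Φ x := by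
  simp only [map_add, map_sub, map_mul, aeval_X, aeval_C, Algebra.algebraMap_eq_smul_one,
    LinearMap.add_apply, LinearMap.sub_apply, Module.End.mul_apply, LinearMap.smul_apply,
    Module.End.one_apply, pow_two, add_apply, sub_apply, zsmul_apply, translate_apply]

/-! ### §3. The resultant identity in `ℤ[X]` -/

/-- `χ = X² - tX + q` is monic. [folklore] -/
private theorem monic_quadratic (t q : ℤ) : (X ^ 2 - C t * X + C q : ℤ[X]).Monic := by
  have h : (X ^ 2 - C t * X + C q : ℤ[X]) = X ^ 2 + (C (-t) * X + C q) := by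
    rw [map_neg]; ring
  rw [h]
  exact monic_X_pow_add ((degree_linear_le).trans_lt (by norm_num))

/-- Division of `X^m` by the monic quadratic `χ`: `X^m = χ·V + (aX + b')` with integers `a, b'`
(Mathlib `modByMonic` / `divByMonic`). [folklore] -/
private theorem X_pow_eq_mul_divByMonic_add (t q : ℤ) (m : ℕ) :
    ∃ (V : ℤ[X]) (a b' : ℤ), (X : ℤ[X]) ^ m = (X ^ 2 - C t * X + C q) * V + (C a * X + C b') := by
  set χ : ℤ[X] := X ^ 2 - C t * X + C q with hχ
  have hmo : χ.Monic := monic_quadratic t q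
  set R : ℤ[X] := X ^ m %ₘ χ with hR
  have hdeg : χ.natDegree ≤ 2 := by
    have h : χ = C 1 * X ^ 2 + C (-t) * X + C q := by rw [hχ, map_neg, map_one]; ring
    rw [h]
    exact natDegree_quadratic_le
  have hRdeg : R.natDegree ≤ 1 := by
    by_cases hR0 : R = 0
    · rw [hR0, natDegree_zero]; exact zero_le_one
    · have h := natDegree_lt_natDegree hR0 (degree_modByMonic_lt (X ^ m) hmo)
      omega
  refine ⟨X ^ m /ₘ χ, R.coeff 1, R.coeff 0, ?_⟩
  have h1 := modByMonic_add_div (X ^ m : ℤ[X]) χ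
  have h2 := eq_X_add_C_of_natDegree_le_one hRdeg
  rw [← hR] at h1
  linear_combination h2 - h1

/-- **The resultant identity** `χ·U = d + W·(X^m - 1)` in `ℤ[X]`, with `W = aX - (ta + b)`,
`U = a² + W·V`, `b = b' - 1`, `d = a²q + tab + b² = Res(χ, X^m - 1)`, given the division
`X^m = χ·V + (aX + b')` (pure ring identity). [folklore] -/
private theorem chi_mul_U_eq (t q a b' : ℤ) (V : ℤ[X]) (m : ℕ)
    (h : (X : ℤ[X]) ^ m = (X ^ 2 - C t * X + C q) * V + (C a * X + C b')) :
    (X ^ 2 - C t * X + C q : ℤ[X]) * (C (a ^ 2) + (C a * X - C (t * a + (b' - 1))) * V) =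
      C (a ^ 2 * q + t * a * (b' - 1) + (b' - 1) ^ 2) +
        (C a * X - C (t * a + (b' - 1))) * (X ^ m - 1) := by
  rw [h]
  simp only [map_add, map_sub, map_mul, map_pow, map_one]
  ring

/-- **Non-vanishing of the resultant**: for `m` odd, `q ≠ ±1` and `t ≠ q + 1`, the integer
`d = a²q + tab + b²` (`b = b' - 1`) is non-zero.  (If `a = 0` then `b = 0` would give `χ ∣ X^m - 1`,
so `q = χ(0)` divides `1`; if `a ≠ 0` and `d = 0` then `r = -b/a ∈ ℚ` is a root of `χ` with `r^m = 1`,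
whence `r = 1` as `m` is odd, i.e. `χ(1) = 1 - t + q = 0`.) [folklore] -/
private theorem resultant_ne_zero {t q a b' : ℤ} {V : ℤ[X]} {m : ℕ} (hm : Odd m)
    (h : (X : ℤ[X]) ^ m = (X ^ 2 - C t * X + C q) * V + (C a * X + C b'))
    (hq1 : q ≠ 1) (hq2 : q ≠ -1) (ht : t ≠ q + 1) :
    a ^ 2 * q + t * a * (b' - 1) + (b' - 1) ^ 2 ≠ 0 := by
  intro hd
  have hm0 : m ≠ 0 := by rintro rfl; exact Nat.not_odd_zero hm
  by_cases ha : a = 0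
  · subst ha
    have hb : b' = 1 := by
      have h2 : (b' - 1) ^ 2 = 0 := by simpa using hd
      have h3 : b' - 1 = 0 := (pow_eq_zero_iff two_ne_zero).mp h2
      omega
    subst hb
    -- evaluate `X^m = χ·V + (0·X + 1)` at `X = 0`: `0 = q · V(0) + 1`
    have h0 := congrArg (Polynomial.eval 0) h
    simp only [eval_pow, eval_X, zero_pow hm0, zero_pow two_ne_zero, eval_add, eval_mul, eval_sub,
      eval_C, eval_one, mul_zero, sub_zero, zero_add, map_zero, zero_mul, map_one] at h0
    have hu : IsUnit q := IsUnit.of_mul_eq_one (-Polynomial.eval 0 V) (by rw [mul_neg]; linarith)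
    rcases Int.isUnit_iff.mp hu with h1 | h1
    · exact hq1 h1
    · exact hq2 h1
  · -- evaluate at the rational number `r = -b/a`
    set b : ℤ := b' - 1 with hb
    set r : ℚ := -(b : ℚ) / a with hr
    have ha' : (a : ℚ) ≠ 0 := by exact_mod_cast ha
    have hL : (a : ℚ) * r + b = 0 := by rw [hr]; field_simp; ring
    have e : ∀ z : ℤ, algebraMap ℤ ℚ z = z := fun z ↦ eq_intCast _ z
    -- `χ(r) = 0` from `a² χ(r) = W(r)·(a r + b) + d`
    have hχr : r ^ 2 - t * r + q = 0 := by
      have hd' : ((a : ℚ)) ^ 2 * q + t * a * b + b ^ 2 = 0 := by exact_mod_cast hd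
      have key : (a : ℚ) ^ 2 * (r ^ 2 - t * r + q) =
          (a * r - (t * a + b)) * (a * r + b) + (a ^ 2 * q + t * a * b + b ^ 2) := by ring
      rw [hL, mul_zero, zero_add, hd'] at key
      exact (mul_eq_zero.mp key).resolve_left (pow_ne_zero 2 ha')
    -- `r^m = 1` from the division identity evaluated at `r`
    have hrm : r ^ m = 1 := by
      have h' := congrArg (fun P : ℤ[X] ↦ aeval r P) h
      simp only [map_pow, aeval_X, map_add, map_sub, map_mul, aeval_C, e] at h'
      rw [hχr, zero_mul, zero_add] at h'
      -- `h' : r ^ m = a * r + b'`, and `a r + b' = (a r + b) + 1 = 1`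
      rw [h']
      have : (b' : ℚ) = b + 1 := by rw [hb]; push_cast; ring
      rw [this, ← add_assoc, hL, zero_add]
    -- `m` odd forces `r = 1`
    have hr1 : r = 1 := (hm.strictMono_pow (R := ℚ)).injective (by simpa using hrm)
    rw [hr1] at hχr
    apply ht
    have : (t : ℚ) = q + 1 := by linarith
    exact_mod_cast this

/-! ### §4. Dividing smooth functions by integers (inside a fixed level) -/

/-- A smooth function of level `N` is `p^j` times a smooth function of level `N` when `A` is
`p`-divisible (divide pointwise by a chosen `p^j`-th root map; torsion exponents add).
[folklore] -/
private theorem exists_pow_smul_eq_of_level (hdiv : ∀ y : A, ∃ x : A, p • x = y) (j : ℕ)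
    (Ψ : BigRepModule 𝒪 p A) {N : ℕ} (hΨ : IsSmoothOfLevel p A N Ψ) :
    ∃ Φ : BigRepModule 𝒪 p A, IsSmoothOfLevel p A N Φ ∧ p ^ j • Φ = Ψ := by
  induction j with
  | zero => exact ⟨Ψ, hΨ, by rw [pow_zero, one_smul]⟩
  | succ j ih =>
    obtain ⟨Φ, hΦ, hΦΨ⟩ := ih
    choose δ hδ using hdiv
    obtain ⟨k, hk⟩ := Φ.exists_torsion
    refine ⟨mk (fun x ↦ δ (Φ x)) ⟨⟨N, fun x y hxy ↦ congrArg δ (hΦ x y hxy)⟩, ⟨k + 1, fun x ↦ ?_⟩⟩,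
      fun x y hxy ↦ congrArg δ (hΦ x y hxy), ?_⟩
    · rw [pow_succ, mul_smul, hδ, hk]
    · rw [← hΦΨ, pow_succ, mul_smul]
      congr 1
      ext x
      rw [nsmul_apply, mk_apply, hδ]

/-- A smooth function of level `N` is `d` times a smooth function of level `N` for every non-zero
integer `d`, when `A` is `p`-divisible: write `|d| = p^j d'` with `p ∤ d'`; `d'` is inverted modulo a
power of `p` killing the values. [folklore] -/
private theorem exists_zsmul_eq_of_level (hdiv : ∀ y : A, ∃ x : A, p • x = y) {d : ℤ} (hd : d ≠ 0)
    (Ψ : BigRepModule 𝒪 p A) {N : ℕ} (hΨ : IsSmoothOfLevel p A N Ψ) :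
    ∃ Φ : BigRepModule 𝒪 p A, IsSmoothOfLevel p A N Φ ∧ d • Φ = Ψ := by
  have hp : p.Prime := Fact.out
  obtain ⟨j, d', hd', hn⟩ := Nat.exists_eq_pow_mul_and_not_dvd (Int.natAbs_ne_zero.mpr hd) p hp.ne_one
  obtain ⟨Φ, hΦ, hΦΨ⟩ := exists_pow_smul_eq_of_level hdiv j Ψ hΨ
  obtain ⟨K, hK⟩ := Φ.exists_torsion
  -- `p^(K+1)` kills `Φ`
  have hK' : p ^ (K + 1) • Φ = 0 := by
    ext x
    rw [nsmul_apply, zero_apply, pow_succ', mul_smul, hK, smul_zero]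
  -- invert `d'` modulo `p^(K+1)`
  have hcop : Nat.Coprime d' (p ^ (K + 1)) :=
    (Nat.coprime_comm.mp ((Nat.Prime.coprime_iff_not_dvd hp).mpr hd')).pow_right _
  obtain ⟨u, -, hu⟩ := Nat.exists_mul_mod_eq_one_of_coprime hcop
    (Nat.one_lt_pow (Nat.succ_ne_zero K) hp.one_lt)
  have hfix : (d' * u) • Φ = Φ := by
    conv_lhs => rw [← Nat.div_add_mod (d' * u) (p ^ (K + 1)), hu, add_smul, one_smul, mul_comm,
      mul_smul, hK', smul_zero, zero_add]
  refine ⟨(d.sign * u : ℤ) • Φ, isSmoothOfLevel_zsmul hΦ _, ?_⟩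
  rw [smul_smul, ← mul_assoc, Int.mul_sign_self, hn]
  push_cast
  rw [show ((p : ℤ) ^ j * (d' : ℤ) * (u : ℤ)) = ((p ^ j * (d' * u) : ℕ) : ℤ) by push_cast; ring,
    natCast_zsmul, mul_smul, hfix, hΦΨ]

/-! ### §5. The engine: `χ(τ_c)` is surjective -/

variable (𝒪) in
/-- **`χ(τ_c) = τ_{2c} - t·τ_c + q` is SURJECTIVE on the smooth `p`-primary functions `ℤ_p → A`**, for
every `c ∈ ℤ_p`, `p` odd, `A` `p`-divisible, and integers `q ≠ ±1`, `t ≠ q + 1`.  Proof: given `Ψ` of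
level `N`, put `m = p^N` (odd); on level-`N` functions `τ_c^m = 1`, so the resultant identity
`χ(τ_c)·U(τ_c) = d + W(τ_c)·(τ_c^m - 1)` reads `χ(τ_c)·U(τ_c) = d` there; `d ≠ 0` divides `Ψ` inside
level `N` (§4), and `Φ = U(τ_c)(Ψ/d)` solves `χ(τ_c)Φ = Ψ`.  (For `c = κ(Frob_w)` this is the
`Λ`-module statement "`q_w[2c] - a_w[c] + 1 ∈ ℤ[Γ]` acts surjectively on `T ⊗ Λ^*`", the determinant
of `Frob_w - 1`; cf. [Castella2018] §2.2 citing [PW11].) [cite: Castella2018, §2.2 (ℋ^ur_v vanishes, via [PW11])] -/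
theorem aeval_translate_quadratic_surjective (hp : p ≠ 2) (hdiv : ∀ y : A, ∃ x : A, p • x = y)
    {t q : ℤ} (hq1 : q ≠ 1) (hq2 : q ≠ -1) (ht : t ≠ q + 1) (c : ℤ_[p]) :
    Function.Surjective
      (aeval (translate c : Module.End 𝒪 (BigRepModule 𝒪 p A)) (X ^ 2 - C t * X + C q)) := by
  intro Ψ
  have hpr : p.Prime := Fact.out
  obtain ⟨N, hN⟩ := Ψ.exists_level
  set σ : Module.End 𝒪 (BigRepModule 𝒪 p A) := translate c with hσ
  have hm : Odd (p ^ N) := (hpr.odd_of_ne_two hp).pow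
  obtain ⟨V, a, b', hdivX⟩ := X_pow_eq_mul_divByMonic_add t q (p ^ N)
  have hd := resultant_ne_zero hm hdivX hq1 hq2 ht
  obtain ⟨Φ₁, hΦ₁, hΦ₁Ψ⟩ := exists_zsmul_eq_of_level hdiv hd Ψ hN
  refine ⟨aeval σ (C (a ^ 2) + (C a * X - C (t * a + (b' - 1))) * V) Φ₁, ?_⟩
  have key := congrArg (fun P : ℤ[X] ↦ aeval σ P Φ₁) (chi_mul_U_eq t q a b' V (p ^ N) hdivX)
  simp only [map_mul, Module.End.mul_apply] at key
  -- on the level-`N` function `Φ₁`, `σ^{p^N} = 1`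
  have hvan : aeval σ ((X : ℤ[X]) ^ p ^ N - 1) Φ₁ = 0 := by
    rw [map_sub, map_pow, aeval_X, map_one, LinearMap.sub_apply, Module.End.one_apply, hσ,
      translate_pow_prime_pow_apply_of_level hΦ₁ c, sub_self]
  rw [key, map_add, LinearMap.add_apply, aeval_C, Algebra.algebraMap_eq_smul_one,
    LinearMap.smul_apply, Module.End.one_apply, hΦ₁Ψ, map_mul, Module.End.mul_apply, hvan,
    map_zero, add_zero]

/-! ### §6. `Frob - 1` on the co-induced representation -/

variable [TopologicalSpace 𝒪] [TopologicalSpace A] [DiscreteTopology A] {G : Type*} [Group G]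
  [TopologicalSpace G] [ContinuousMul G] [TopologicalSpace (PowerSeries 𝒪)]

open Literature.NumberTheory.GaloisRepresentations

/-- **`g - 1` is SURJECTIVE on `T ⊗ Λ^*(Ψ⁻¹) = BigRepModule 𝒪 p A`** whenever `ρ(g)` satisfies a
Cayley–Hamilton relation `ρ(g)² y = t·ρ(g) y - q·y` on `A` with integers `q ≠ ±1`, `t ≠ q + 1` (`p`
odd, `A` `p`-divisible).  Mechanism: with `τ = τ_{-κ g}` and `A_g = ρ(g)_*` (which commute),
`g - 1 = A_g τ - 1` and `(A_g τ - 1)((t - A_g)τ - 1) = q τ² - t τ + 1 = τ² χ(τ⁻¹)`, so §5 applies.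
Intended instance: `A = E[p^∞]`, `g` a Frobenius lift at a place `w ∤ p` of good reduction
(`t = a_w`, `q = q_w = N w ≥ 2`, `a_w ≠ q_w + 1` because `#Ẽ_w(k_w) ≥ 1`; Cayley–Hamilton from the
tree's `charpoly_galoisRepTate_of_hasGoodReductionAt`), giving `ℋ^ur_w(𝒜) = 0`:
"`ℋ^ur_v` vanishes … `ℋ^ur_w ≃ (ℤ_p/p^{t_E(w)}) ⊗ Λ^*`" with `t_E(w) = 0`.
[cite: Castella2018, §2.2 (the two sentences on ℋ^ur_v, ℋ^ur_w after Prop. 2.5)] -/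
theorem bigRep_sub_self_surjective (κ : G →ₜ* Multiplicative ℤ_[p]) (ρ : ContinuousRep G 𝒪 A)
    (hp : p ≠ 2) (hdiv : ∀ y : A, ∃ x : A, p • x = y) {t q : ℤ} (hq1 : q ≠ 1) (hq2 : q ≠ -1)
    (ht : t ≠ q + 1) (g : G) (hCH : ∀ y : A, ρ g (ρ g y) = t • ρ g y - q • y) :
    Function.Surjective fun Φ : BigRepModule 𝒪 p A ↦ bigRep κ ρ g Φ - Φ := by
  intro Ψ
  set c : ℤ_[p] := (κ g).toAdd with hc
  obtain ⟨Θ, hΘ⟩ :=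
    aeval_translate_quadratic_surjective 𝒪 hp hdiv hq1 hq2 ht c (translate (c + c) Ψ)
  refine ⟨t • translate (-c) Θ - mapRange (ρ g) (translate (-c) Θ) - Θ, ?_⟩
  ext x
  have key := congrArg (fun Φ : BigRepModule 𝒪 p A ↦ Φ (x - c - c)) hΘ
  simp only [aeval_translate_quadratic_apply, translate_apply, sub_add_cancel,
    show x - c - c + (c + c) = x by abel] at key
  simp only [sub_apply, bigRep_apply_apply, zsmul_apply, translate_apply, mapRange_apply, ← hc,
    ← sub_eq_add_neg, map_sub, map_zsmul, hCH]
  rw [← key]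
  abel

end Literature.NumberTheory.EllipticCurves.BigRepModule

end
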